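/-
Origin: expansion seat `planner-pub-hodgecm-pv11-g2-0`, handover #5 2026-08-18T05:09:19Z (`HOME/pub-hodgecm-pv11-g2/lean/Pv11g2/GlobalLatticeDiscrete.lean`, md5 c5cdb3dd, 132 lines);
landed by the gen-6 packager in gate run 22 as `HodgeCM/PerL34/GlobalLatticeDiscrete.lean` (import ^import Pv[0-9]+g[0-9]+\.→import HodgeCM.PerL34. ×1; stripped 3 #print/#check/#eval lines).
-/
/-
Origin: HOME/pub-hodgecm-pv11-g2/lean/Pv11g2/GlobalLatticeDiscrete.lean — session planner-pub-hodgecm-pv11-g2-0 (unit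
pub-hodgecm-pv11-g2, DAG-NODE PROVER #11 gen 2).  Intended final place: `HodgeCM/PerL34/GlobalLatticeDiscrete.lean`
(rename `import Pv11g2.SupplyCoset` ↦ `import HodgeCM.PerL34.SupplyCoset`; lands AFTER `SupplyCoset.lean`).
Closed; axioms = standard trio; no non-Mathlib input.
-/
import Summits.HodgeConjecture.HodgeCM.PerL34.SupplyCoset

set_option autoImplicit false

/-!
# The global lattice `V(K) ∩ L̂` is finitely generated and free — from discreteness at the archimedean place

`SupplyCoset.supply₁/₂_of_coset(_schwartz)` and the bridge record `SupplyDictionaryE.SupplyBridgeE` carry the two SETUP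
instance hypotheses `[Module.Free ℤ (globalLattice ιf Lhat)]`, `[Module.Finite ℤ (globalLattice ιf Lhat)]`
("`V(K) ∩ L̂` is a finitely generated free `ℤ`-module").  In the presence of the archimedean data that the Schwartz
corollary and the record ALREADY carry — an additive map `ι : V(K) → E` into a finite-dimensional real normed space, a
discrete `ℤ`-submodule `LE ≤ E`, `ι (globalLattice) ⊆ LE`, and `ι` injective on `globalLattice` — both are THEOREMS:
`globalLattice ≃ₗ[ℤ] ι(globalLattice) ≤ LE` is a discrete `ℤ`-submodule of `E`, hence finitely generated and free
(Mathlib `instModuleFinite_of_discrete_submodule`, `instModuleFree_of_discrete_submodule`).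

Consequences recorded here: `finite_of_embedding`, `free_of_embedding` (fill the record fields `instFin := …`,
`instFree := …` by name), and `supply₁_of_coset_schwartz'` = `SupplyCoset.supply₁_of_coset_schwartz` WITHOUT the two
instance hypotheses.
-/

noncomputable section

open scoped SchwartzMap

namespace HodgeCM
namespace PerL34
namespace GlobalLatticeDiscrete

open RationalCoset SupplyElementary

variable {VK Vf : Type*} [AddCommGroup VK] [Module ℚ VK] [AddCommGroup Vf] [Module ℚ Vf]
  (ιf : VK →ₗ[ℚ] Vf) (Lhat : Submodule ℤ Vf)
  {E : Type*} [NormedAddCommGroup E] (LE : Submodule ℤ E) (ι : VK →+ E)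

/-- The image of the global lattice under the archimedean embedding, as a `ℤ`-submodule of `E`. -/
def imageLattice : Submodule ℤ E := (globalLattice ιf Lhat).map ι.toIntLinearMap

/-- (Ported verbatim from the HodgeCMPerL package; no docstring in the source.) -/
theorem mem_imageLattice_of_mem {v : VK} (hv : v ∈ globalLattice ιf Lhat) :
    ι v ∈ imageLattice ιf Lhat ι :=
  Submodule.mem_map_of_mem hv

variable {ιf Lhat LE ι}

/-- (Ported verbatim from the HodgeCMPerL package; no docstring in the source.) -/
theorem imageLattice_le (hL : ∀ v ∈ globalLattice ιf Lhat, ι v ∈ LE) : imageLattice ιf Lhat ι ≤ LE := by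
  rintro x ⟨v, hv, rfl⟩
  exact hL v hv

/-- The image lattice is discrete, being contained in the discrete submodule `LE`. -/
theorem discreteTopology_imageLattice [DiscreteTopology LE] (hL : ∀ v ∈ globalLattice ιf Lhat, ι v ∈ LE) :
    DiscreteTopology (imageLattice ιf Lhat ι) :=
  DiscreteTopology.of_subset (s := (LE : Set E)) (t := (imageLattice ιf Lhat ι : Set E)) ‹_›
    (imageLattice_le hL)

variable (ιf Lhat ι) in
/-- The embedding restricted to the global lattice, onto its image. -/
def toImage : globalLattice ιf Lhat →ₗ[ℤ] imageLattice ιf Lhat ι where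
  toFun v := ⟨ι v, mem_imageLattice_of_mem ιf Lhat ι v.2⟩
  map_add' v w := by ext; simp
  map_smul' n v := by ext; simp

/-- (Ported verbatim from the HodgeCMPerL package; no docstring in the source.) -/
@[simp] theorem coe_toImage (v : globalLattice ιf Lhat) : (toImage ιf Lhat ι v : E) = ι v := rfl

/-- (Ported verbatim from the HodgeCMPerL package; no docstring in the source.) -/
theorem toImage_bijective (hinj : Set.InjOn ι (globalLattice ιf Lhat)) :
    Function.Bijective (toImage ιf Lhat ι) := by
  constructor
  · intro v w h
    have h' : ι v = ι w := congrArg Subtype.val h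
    exact Subtype.ext (hinj v.2 w.2 h')
  · rintro ⟨x, v, hv, rfl⟩
    exact ⟨⟨v, hv⟩, rfl⟩

/-- `globalLattice ≃ₗ[ℤ] imageLattice` when the archimedean embedding is injective on the global lattice. -/
def equivImage (hinj : Set.InjOn ι (globalLattice ιf Lhat)) :
    globalLattice ιf Lhat ≃ₗ[ℤ] imageLattice ιf Lhat ι :=
  LinearEquiv.ofBijective (toImage ιf Lhat ι) (toImage_bijective hinj)

variable [NormedSpace ℝ E] [FiniteDimensional ℝ E]

/-- **`V(K) ∩ L̂` is finitely generated** (from discreteness of its archimedean image). -/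
theorem finite_of_embedding [DiscreteTopology LE] (hL : ∀ v ∈ globalLattice ιf Lhat, ι v ∈ LE)
    (hinj : Set.InjOn ι (globalLattice ιf Lhat)) : Module.Finite ℤ (globalLattice ιf Lhat) := by
  haveI := discreteTopology_imageLattice hL
  exact Module.Finite.equiv (equivImage hinj).symm

/-- **`V(K) ∩ L̂` is free** (from discreteness of its archimedean image). -/
theorem free_of_embedding [DiscreteTopology LE] (hL : ∀ v ∈ globalLattice ιf Lhat, ι v ∈ LE)
    (hinj : Set.InjOn ι (globalLattice ιf Lhat)) : Module.Free ℤ (globalLattice ιf Lhat) := by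
  haveI := discreteTopology_imageLattice hL
  exact Module.Free.of_equiv (equivImage hinj).symm

/-- **Route (E), Schwartz form, with the finiteness/freeness of `V(K) ∩ L̂` DERIVED.**  Same statement as
`SupplyCoset.supply₁_of_coset_schwartz` minus the instance hypotheses `[Module.Free ℤ (globalLattice ιf Lhat)]`,
`[Module.Finite ℤ (globalLattice ιf Lhat)]`. -/
theorem supply₁_of_coset_schwartz' (ιf : VK →ₗ[ℚ] Vf) (Lhat : Submodule ℤ Vf)
    (LE : Submodule ℤ E) [DiscreteTopology LE] (ι : VK →+ E)
    (hL : ∀ v ∈ globalLattice ιf Lhat, ι v ∈ LE) (hinj : Set.InjOn ι (globalLattice ιf Lhat))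
    (DS : Seesaw.ThetaSeesawData)
    [CommGroup DS.A₁] [TopologicalSpace DS.A₁] [IsTopologicalGroup DS.A₁] [CompactSpace DS.A₁]
    [MeasurableSpace DS.A₁] [BorelSpace DS.A₁]
    (ν₁ : MeasureTheory.Measure DS.A₁) [MeasureTheory.IsFiniteMeasure ν₁] [ν₁.IsOpenPosMeasure]
    [ν₁.IsMulRightInvariant]
    (hsep : CharSeparating DS.A₁)
    {B : Type*} [Monoid B] (i : B →* DS.A₁) (w : B → ℂ)
    (f : 𝓢(E, ℂ)) (x₀ : VK) (hx₀ : f (ι x₀) ≠ 0)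
    (φN : ℕ → DS.S₁) (g₀ : DS.G) (u₀ : DS.A₁)
    (hker : ∀ N : ℕ, N ≠ 0 →
      DS.thetaKernel₁ (φN N) g₀ u₀ = ∑' ξ : VK, (thinCosetK ιf Lhat x₀ N).indicator (fun ξ => f (ι ξ)) ξ)
    (hcont : ∀ N, Continuous fun u => DS.thetaKernel₁ (φN N) g₀ u)
    (heq : ∀ (N : ℕ) (u : DS.A₁) (t : B),
      DS.thetaKernel₁ (φN N) g₀ (u * i t) = w t * DS.thetaKernel₁ (φN N) g₀ u) :
    ∃ (N : ℕ) (χ : PontryaginDual DS.A₁), 0 < N ∧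
      DS.thetaLift₁ ν₁ (fun u => ((χ u : Circle) : ℂ)) (φN N) g₀ ≠ 0 ∧
      ∀ t : B, ((χ (i t) : Circle) : ℂ) * w t = 1 := by
  haveI := finite_of_embedding hL hinj
  haveI := free_of_embedding hL hinj
  exact SupplyCoset.supply₁_of_coset_schwartz DS ν₁ hsep i w ιf Lhat LE ι hL hinj f x₀ hx₀ φN g₀ u₀ hker hcont heq

end GlobalLatticeDiscrete
end PerL34
end HodgeCM

end

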